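import Summits.BirchSwinnertonDyer.BirchSwinnertonDyer.Theorems.ManinLocalTwoThreeManinPrimeToAdditiveFiveLeLedgerFourPrintsNoDD
import HarnessLib

/-!
# Route `ManinLocalTwoThree` ∩ route `TwistFamilyManinDescent`, shared residual crux C5 `ManinPrimeToAdditiveFiveLe` (stmt-BirchSwinnertonDyer-22969):
# TFMD's glue `EisensteinResidualOfTrichotomy` (stmt-BirchSwinnertonDyer-25945, R ⟸ C1 ∧ C2 ∧ F ∧ CM163 ∧ Ray57 ∧ Corner57) WITHOUT the
# Dokchitser–Dokchitser rigidity hypothesis — the OTHER book of C5 loses the same print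

Width seat bsd-line-ml23-c5-p1-w2 (gen 6), piece ω5. THEOREMS ONLY (no definition, no named fact, no `sorry`).

pub/bsd-wall's `eisensteinResidualOfTrichotomy_of_jTable_of_dokchitserOrdinary` / `…_of_largePrimeReducibleJ_of_dokchitserOrdinary`
(`TwistFamilyManinDescentEisensteinResidualOfTrichotomy.lean`) grant TWO printed facts beyond the glue's antecedents: the `j`-table (resp. the route
item `LargePrimeReducibleJ`) and `dokchitser_padicValInt_minimalDiscriminantInt_eq_of_isogeny_of_potentiallyGoodOrdinary`. The second is used only
inside the `13`-core, whose hDD-free form `not_dvd_c_large_noDD` (piece ω3, on the rigidity THEOREM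
`padicValInt_minimalDiscriminantInt_eq_of_isIsogenous_of_typeGOrd`, piece ω1 p639486) this file threads through:
`eisensteinAdditiveManinResidual_of_children_of_not_typeGOrd_noDD` (statement VERBATIM minus `hDD`, proof adapted verbatim),
**`eisensteinResidualOfTrichotomy_of_jTable : primeDegreeIsogeny_jTable → EisensteinResidualOfTrichotomy`** and
**`eisensteinResidualOfTrichotomy_of_largePrimeReducibleJ : LargePrimeReducibleJ → EisensteinResidualOfTrichotomy`** (every input a registered decl
of route `TwistFamilyManinDescent`).

HONEST STATUS (`--supports 22969`, helper): C1, C2, Ray57, Corner57, R are OPEN items; the `j`-table is cite-only / `LargePrimeReducibleJ` an open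
support item. Nothing here proves BSD, Manin's conjecture, R, C5 or any leaf; the gain is one printed hypothesis fewer on TFMD's assembly of X₅ = C5.

References: [EdixhovenManin1991] Thm. 3, §4; [Mazur1978] Thm. 1; [DokchitserDokchitser2015LocalInvariants] Thm. 5.1 (1) (now a tree theorem at
`p ≥ 5` on the (G)-locus).
-/

set_option autoImplicit false
-- single-conjunct summit: `Summit.BirchSwinnertonDyer.BirchSwinnertonDyer.…` repeats the name by design
set_option linter.dupNamespace false

noncomputable section

open scoped Classical NumberField

open WeierstrassCurve IsDedekindDomain Rat.HeightOneSpectrum NumberField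
  Literature.NumberTheory.EllipticCurves Literature.NumberTheory.EllipticCurves.ModularForms
  Literature.NumberTheory.EllipticCurves.Rank1Residual
  Summit.BirchSwinnertonDyer.Rank1Residual Summit.BirchSwinnertonDyer.Rank1Residual.Additive
  Summit.BirchSwinnertonDyer.Rank1Residual.ManinAdditive
  Summit.BirchSwinnertonDyer.BirchSwinnertonDyer.Theorems.TeichmullerTwistDescentStarInvolution
  Summit.BirchSwinnertonDyer.BirchSwinnertonDyer.Theses.TwistFamilyManinDescent

namespace Summit.BirchSwinnertonDyer.BirchSwinnertonDyer.Theorems.TwistFamilyManinDescent.EisensteinTrichotomy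

open TeichmullerTwistDescent.TwistedPeriodLatticeIndexFrame

/-! ### R from its children and the glue, without `hDD` -/

/-- **R from its children with the `163`-corner supplied as a function — and NO rigidity hypothesis** (the `13`-core runs on
the tree THEOREM `padicValInt_minimalDiscriminantInt_eq_of_isIsogenous_of_typeGOrd` via `not_dvd_c_large_noDD`; adapted verbatim from
bsd-line-ttd-p1's `eisensteinAdditiveManinResidual_of_children_of_not_typeGOrd` minus `hDD`) (`h163 : W[163] reducible ⇒ not
(G)-ordinary at 163`, however obtained — from CM163 + the `j`-table fact, or from `LargePrimeReducibleJ` by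
`not_typeGOrd_oneSixtyThree_of_largePrimeReducibleJ`); otherwise word for word the dispatch
`eisensteinAdditiveManinResidual_of_children`. [cite: EdixhovenManin1991, Thm. 3 and §4]
[cite: DokchitserDokchitser2015LocalInvariants, Thm. 5.1 (1)] -/
theorem eisensteinAdditiveManinResidual_of_children_of_not_typeGOrd_noDD
    (h163 : ∀ (W : WeierstrassCurve ℚ) [W.IsElliptic], ¬ W.HasIrreducibleModPGaloisRep 163 → ¬ TypeGOrd W 163)
    (hC1 : EisensteinOrdinaryTwistLatticeNotBottom) (hC2 : EisensteinOrdinaryStrongIsTop)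
    (hF : EdixhovenLargePrimeManinFacts)
    (hRay : EisensteinRaynaudRegimeManinUnit) (hCor : EisensteinCornerManinResidual) :
    EisensteinAdditiveManinResidual := by
  intro hM hAU hC hnf W _ _ N _ D p hp hcases hpN hred _htw hopt
  haveI : Fact p.Prime := ⟨hp⟩
  rcases hcases with rfl | rfl | rfl | ⟨rfl, -⟩
  · by_cases h58 : padicValInt 5 W.minimalDiscriminantInt ∈ ({4, 8} : Finset ℕ)
    · exact hRay hM hAU hC hnf W D 5 hp (Or.inl ⟨rfl, h58⟩) hpN hred _htw hopt
    · refine hCor hM hAU hC hnf W D 5 hp (Or.inl rfl) ?_ hpN hred _htw hopt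
      rintro (⟨-, h⟩ | ⟨h7, -⟩)
      · exact h58 h
      · norm_num at h7
  · by_cases h79 : padicValInt 7 W.minimalDiscriminantInt ∈ ({3, 9} : Finset ℕ)
    · exact hRay hM hAU hC hnf W D 7 hp (Or.inr ⟨rfl, h79⟩) hpN hred _htw hopt
    · refine hCor hM hAU hC hnf W D 7 hp (Or.inr rfl) ?_ hpN hred _htw hopt
      rintro (⟨h5, -⟩ | ⟨-, h⟩)
      · norm_num at h5
      · exact h79 h
  · obtain rfl : N = W.conductorNorm ℤ := IsNewformOf.level_eq_conductorNorm_of_exists_isNewformOf hnf D.isNewformOf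
    exact not_dvd_c_large_noDD hnf hC1 hC2 hF.1 hF.2 W 13 D (by norm_num) (fun h ↦ absurd rfl h) hpN
      hred hopt
  · obtain rfl : N = W.conductorNorm ℤ := IsNewformOf.level_eq_conductorNorm_of_exists_isNewformOf hnf D.isNewformOf
    exact not_dvd_c_large_noDD hnf hC1 hC2 hF.1 hF.2 W 163 D (by norm_num)
      (fun _ h ↦ h163 W hred h.1) hpN hred hopt


/-- **Glue `EisensteinResidualOfTrichotomy` (stmt-BirchSwinnertonDyer-25945) GRANTED ONLY Mazur's `j`-table of prime-degree isogenies**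
(`primeDegreeIsogeny_jTable`, the binder of the antecedent CM163 itself) — Dokchitser–Dokchitser's rigidity is NO LONGER a hypothesis.
Conditional-result; the registered signature is the conclusion VERBATIM. [cite: EdixhovenManin1991, Thm. 3 and §4] [cite: Mazur1978, Thm. 1] -/
theorem eisensteinResidualOfTrichotomy_of_jTable (hT : primeDegreeIsogeny_jTable) :
    EisensteinResidualOfTrichotomy :=
  fun hC1 hC2 hF hCM hRay hCor ↦
    eisensteinAdditiveManinResidual_of_children_of_not_typeGOrd_noDD (fun W _ hred ↦ hCM hT W hred)
      hC1 hC2 hF hRay hCor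

/-- **Glue `EisensteinResidualOfTrichotomy` GRANTED ONLY the route item `LargePrimeReducibleJ` (stmt-BirchSwinnertonDyer-25139)** — every
input is now a registered decl of route `TwistFamilyManinDescent`; no printed rigidity fact. Conditional-result. [cite: Mazur1978, Thm. 1] -/
theorem eisensteinResidualOfTrichotomy_of_largePrimeReducibleJ (hL : LargePrimeReducibleJ) :
    EisensteinResidualOfTrichotomy :=
  fun hC1 hC2 hF _hCM hRay hCor ↦
    eisensteinAdditiveManinResidual_of_children_of_not_typeGOrd_noDD
      (fun W _ hred ↦ not_typeGOrd_oneSixtyThree_of_largePrimeReducibleJ hL W hred) hC1 hC2 hF hRay hCor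

end Summit.BirchSwinnertonDyer.BirchSwinnertonDyer.Theorems.TwistFamilyManinDescent.EisensteinTrichotomy

end
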